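import Summits.QuantumFields.Balaban3D.Proofs.FamilyLE
import HarnessLib

/-!
# `AlphaInputs3D` — Bałaban's (α) input package of the three-dimensional END theorem, as ONE closed proposition

Definition request of route `UnitScaleTilt` (cell ym3-torus, rung R3; crux `UnitTilt`), text of record = the cell's
`TARGET-Dag3.lean` v4 §4 `AlphaInputsLE` (here `AlphaInputs3D.AtScale`).  A route file may import only Mathlib / Literature / HarnessLib / the summit
Statement / `Summits.<P>.Theorems.*`, while the (α) package — the hypotheses of the Balaban3D lane's END theorem
`Summit.QuantumFields.Balaban3D.Proofs.FamilyLE.uvStability3D_of_inputs_le` (CMP 102 Thm 1 on the compact `≤`-family + Thm 2)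
— lives in `Summits.QuantumFields.Balaban3D.Proofs.*`; this file re-homes the HYPOTHESIS LIST (not the theorem) under
`Summits/QuantumFields/YangMills/Theorems` so that the planner can file the glued split `UnitTilt ⇐ AlphaInputs3D → TiltFromAlpha`.

* `AlphaInputs3D.AtScale L` — for block size `L`: there are primitive constants `𝔠 : AlphaConsts L N` (per group as printed), the
  printed external constructions `X : ExternalInputs S G`, the expansion data `𝔖 : StepSeries …` on the `≤`-lane carriers and the
  auxiliary data `𝔄 : AlphaData …`, such that for EVERY lattice approximation `S : Scales L` whose terminal coupling obeys
  `S.g² · S.ε₀ ≤ (min 𝔠.gamma0 1)²` the running inputs `RunAlpha` hold — VERBATIM the binder list of `uvStability3D_of_inputs_le`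
  with its `hα`, existentially closed over the data and universally over the groups.  «g_k in a bounded set» (CMP 102 p.257 L1)
  read as an interval. [cite: Balaban1985UV3, Thm 1 p.257, Thm 2 p.272, (1)–(5) p.256]
* `AlphaInputs3D := ∀ L, Odd L → 1 < L → AlphaInputs3D.AtScale L` — the closed `Prop` (block sizes as `Setup.Params` / `Scales` demand).
* API: `AlphaInputs3D.atScale` (instantiate at an admissible `L`), `AlphaInputs3D.AtScale.uvStability3D` (the package FEEDS the END theorem:
  CMP 102 Thm 1 (compact form) ∧ Thm 2 on the `≤`-family, for every compact group as printed — a one-line application of the lane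
  theorem, recorded so that reviewers see the definition is the right socket), `AlphaInputs3D.uvStability3D`.

Nothing is asserted: `AlphaInputs3D` is an OPEN input package (the cluster-expansion outputs `StepSeries` are not constructed in the
tree; cell record HOME/UV3-NODE.md, 31 rows).  WHAT THIS IS NOT: not d = 4, not a continuum limit, not a statement about expectations.

References: T. Bałaban, «Ultraviolet stability of three-dimensional lattice pure gauge field theories», Commun. Math. Phys. 102
(1985) 255–275 [Balaban1985UV3]; T. Bałaban, «Recent results in constructing gauge fields», Physica A 124 (1984) 79–90, p.84–89
[Balaban1984PhysicaA]; cell records HOME/TARGET-Dag3.lean v4 §4, HOME/route-R3/ym/defreq-AlphaInputs3D.txt.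
-/

set_option autoImplicit false

namespace Summit.QuantumFields.YangMills.Theorems

open Literature.MathematicalPhysics.QuantumFieldTheory.Balaban1983to89
open Literature.MathematicalPhysics.QuantumFieldTheory.Balaban1985CMP102
open Literature.MathematicalPhysics.QuantumFieldTheory.Balaban1985CMP102.Setting
open Summit.QuantumFields.Balaban3D.Carriers
open Summit.QuantumFields.Balaban3D.Proofs.Primitives
open Summit.QuantumFields.Balaban3D.Proofs.GroupModelLieC (lieC)
open Summit.QuantumFields.Balaban3D.Proofs.UVStability3DInputs
open Summit.QuantumFields.Balaban3D.Proofs.FamilyLE (runsLE uvStability3D_of_inputs_le)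

/-- **(α) on the `≤`-family at block size `L`** — the hypothesis list of the Balaban3D END theorem
`FamilyLE.uvStability3D_of_inputs_le`, existentially closed over its data (`𝔠` primitive constants, `X` printed external
constructions, `𝔖` the expansion data on the `≤`-lane carriers, `𝔄` auxiliary data) and universal over compact groups as printed
and over every lattice approximation `S : Scales L` with terminal coupling `S.g²·S.ε₀ ≤ (min 𝔠.gamma0 1)²` («g_k in a bounded set»,
p.257 L1, read as an interval); text of record = cell ym3-torus TARGET-Dag3.lean v4 §4 `AlphaInputsLE`, token for token.
OPEN (an input package; never asserted). [cite: Balaban1985UV3, Thm 1 p.257, Thm 2 p.272, (1)–(5) p.256] -/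
def AlphaInputs3D.AtScale (L : ℕ) : Prop :=
  ∃ (𝔠 : ∀ (G : Type) [GaugeGroup G] [MeasurableSpace G] [HaarData G] (𝔊 : GroupModel G), AlphaConsts L 𝔊.N)
    (X : ∀ (G : Type) [GaugeGroup G] [MeasurableSpace G] [HaarData G], GroupModel G → ∀ S : Scales L, ExternalInputs S G)
    (𝔖 : ∀ (G : Type) [GaugeGroup G] [MeasurableSpace G] [HaarData G] (𝔊 : GroupModel G) (S : Scales L) (k : ℕ),
      StepSeries S G ↥(lieC 𝔊) (nblkOf S (𝔠 G 𝔊).lane.carrier k) k)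
    (𝔄 : ∀ (G : Type) [GaugeGroup G] [MeasurableSpace G] [HaarData G] (𝔊 : GroupModel G) (S : Scales L),
      AlphaData 𝔊 (𝔠 G 𝔊) (X G 𝔊 S) (𝔖 G 𝔊 S)),
    ∀ (G : Type) [GaugeGroup G] [MeasurableSpace G] [HaarData G] (𝔊 : GroupModel G) (S : Scales L),
      S.g ^ 2 * S.ε₀ ≤ (min (𝔠 G 𝔊).gamma0 1) ^ 2 → RunAlpha 𝔊 (𝔠 G 𝔊) (X G 𝔊 S) (𝔖 G 𝔊 S) (𝔄 G 𝔊 S)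

/-- **`AlphaInputs3D`** — Bałaban's (α) input package for the three-dimensional ultraviolet-stability theorem at EVERY admissible
block size (`L` odd, `L > 1`, as `Setup.Params`/`Scales` demand): the closed proposition a route item can name (`∀ L, Odd L → 1 < L →
AlphaInputs3D.AtScale L`; sources as for `AtScale`: CMP 102 Thm 1 p.257, Thm 2 p.272; Physica A 124 p.84–89).  This is a ROUTE
OBJECT (the definition request `defn-AlphaInputs3D` of route `UnitScaleTilt`), not a published fact: it packages hypotheses of a
Summits-side theorem and must live next to it (a Literature module cannot import `Summits.QuantumFields.Balaban3D`).  OPEN (an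
input package, never asserted here). -/
def AlphaInputs3D : Prop :=
  ∀ L : ℕ, Odd L → 1 < L → AlphaInputs3D.AtScale L

/-- Unfolding lemma. -/
theorem alphaInputs3D_iff : AlphaInputs3D ↔ ∀ L : ℕ, Odd L → 1 < L → AlphaInputs3D.AtScale L := Iff.rfl

namespace AlphaInputs3D

/-- Instantiation at an admissible block size (the form `UnitTilt`'s proof consumes at `L = F.L`, with `F.hL : Odd F.L ∧ 1 < F.L`). -/
theorem atScale (h : AlphaInputs3D) {L : ℕ} (hL : Odd L ∧ 1 < L) : AtScale L :=
  h L hL.1 hL.2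

/-- **The package is the END theorem's socket**: `AtScale L` yields, for some data `𝔠 X 𝔖` and EVERY compact group as printed,
CMP 102 Theorem 1 (compact form) and Theorem 2 for all lattice approximations of the `≤`-family `S.g²·S.ε₀ ≤ (min 𝔠.gamma0 1)²` —
one application of `FamilyLE.uvStability3D_of_inputs_le` (p402858). [cite: Balaban1985UV3, Thm 1 p.257, Thm 2 p.272] -/
theorem AtScale.uvStability3D {L : ℕ} (h : AtScale L) :
    ∃ (𝔠 : ∀ (G : Type) [GaugeGroup G] [MeasurableSpace G] [HaarData G] (𝔊 : GroupModel G), AlphaConsts L 𝔊.N)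
      (X : ∀ (G : Type) [GaugeGroup G] [MeasurableSpace G] [HaarData G], GroupModel G → ∀ S : Scales L, ExternalInputs S G)
      (𝔖 : ∀ (G : Type) [GaugeGroup G] [MeasurableSpace G] [HaarData G] (𝔊 : GroupModel G) (S : Scales L) (k : ℕ),
        StepSeries S G ↥(lieC 𝔊) (nblkOf S (𝔠 G 𝔊).lane.carrier k) k),
      ∀ (G : Type) [GaugeGroup G] [MeasurableSpace G] [HaarData G] (𝔊 : GroupModel G),
        B10.Thm1PrintedCompact (runsLE (laneT 𝔠 X 𝔖).toConstruction G 𝔊 ((min (𝔠 G 𝔊).gamma0 1) ^ 2)) ∧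
          B10.Thm2Printed (runsLE (laneT 𝔠 X 𝔖).toConstruction G 𝔊 ((min (𝔠 G 𝔊).gamma0 1) ^ 2)) := by
  obtain ⟨𝔠, X, 𝔖, 𝔄, hα⟩ := h
  exact ⟨𝔠, X, 𝔖, fun G _ _ _ 𝔊 => uvStability3D_of_inputs_le 𝔠 X 𝔖 𝔄 G 𝔊 (hα G 𝔊)⟩

/-- `AlphaInputs3D` delivers CMP 102 Theorems 1–2 on the `≤`-family at every admissible block size. [cite: Balaban1985UV3, Thm 1 p.257, Thm 2 p.272] -/
theorem uvStability3D (h : AlphaInputs3D) {L : ℕ} (hL : Odd L ∧ 1 < L) :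
    ∃ (𝔠 : ∀ (G : Type) [GaugeGroup G] [MeasurableSpace G] [HaarData G] (𝔊 : GroupModel G), AlphaConsts L 𝔊.N)
      (X : ∀ (G : Type) [GaugeGroup G] [MeasurableSpace G] [HaarData G], GroupModel G → ∀ S : Scales L, ExternalInputs S G)
      (𝔖 : ∀ (G : Type) [GaugeGroup G] [MeasurableSpace G] [HaarData G] (𝔊 : GroupModel G) (S : Scales L) (k : ℕ),
        StepSeries S G ↥(lieC 𝔊) (nblkOf S (𝔠 G 𝔊).lane.carrier k) k),
      ∀ (G : Type) [GaugeGroup G] [MeasurableSpace G] [HaarData G] (𝔊 : GroupModel G),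
        B10.Thm1PrintedCompact (runsLE (laneT 𝔠 X 𝔖).toConstruction G 𝔊 ((min (𝔠 G 𝔊).gamma0 1) ^ 2)) ∧
          B10.Thm2Printed (runsLE (laneT 𝔠 X 𝔖).toConstruction G 𝔊 ((min (𝔠 G 𝔊).gamma0 1) ^ 2)) :=
  (h.atScale hL).uvStability3D

end AlphaInputs3D

end Summit.QuantumFields.YangMills.Theorems
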